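import Summits.HodgeConjecture.HodgeConjecture.Theorems.TropicalWeilObstructionTropicalWeilVanishingFrameSpanMaster
import Summits.HodgeConjecture.HodgeConjecture.Theorems.TropicalWeilObstructionTropicalHodgeBoundThetaLine
import HarnessLib

/-!
# Route `TropicalWeilObstruction` (Kontsevich's tropical test — NEGATION SINK, exploration, no summit claim):
# the frame span of an effective tropical `4`-cycle on a very general tropical Weil eightfold — II. the Weil plane

Negation-sink bookkeeping of the cell `pub-hodge-tropical` (seat tropical-1 gen 6); part II of four (see
`…FrameSpanMaster` for the setting and the master identity). For a NON-EMPTY effective tropical `4`-cycle `Z` on a very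
general principally polarised tropical Weil eightfold `ℝ⁸/Qℤ⁸`:

* `alt_annihilator_mem_weilPlane` — every real function on words annihilating all Plücker vectors `p_σ` of the cells has
  alternating projection in `span_ℝ{Re Ω, Im Ω}`: up to non-alternating noise, the only linear forms on `⋀⁴ℝ⁸` that can
  vanish on all frames of `Z` are those of the WEIL PLANE `⟨Re dz̄, Im dz̄⟩` — the frames span at least the
  `68`-dimensional kernel of `dz₁ ∧ dz₂ ∧ dz₃ ∧ dz₄`;
* `alt_eq_zero_of_annihilator_orthogonal_omega` — adding `Re Ω`, `Im Ω` to the frames leaves no alternating form;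
* `alt_eq_zero_of_annihilator_of_weilFunctional_eq_zero` — if `W(Z) = 0` (what the open crux K1 predicts) the frames
  ALONE leave no alternating form (`cyc Z = r θ₄(Q)`, p329881);
* `thetaZ_wordOfRank` (decided Kronecker table `det 1[I_i,I_j] = [i = j]` on K3's `70` increasing words), `alt_lift`,
  `sum_mul_lift` — reading the identities on increasing words;
* `annihilator_pairwise_dependent` — in `ℝ⁷⁰` (values on increasing words) the annihilator of the restricted frames is at
  most a LINE: `c = Re(λ z_c Ω̂)`, `z_c = Σ_r Ω(I_r) c_r`, and `(2 - λP) z_c = N λ̄ z̄_c` with `N = Σ_r |Ω(I_r)|² > 0`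
  forces any two annihilators to be dependent.

HONEST STATUS. Linear algebra; decides nothing about K1 or the Hodge conjecture. No definition, no named fact, no sorry.

References: [Zharkov2020TropicalWeil] I. Zharkov, arXiv:2002.02347, §2 (pp. 2–4); [MikhalkinZharkov2014Eigenwave]
G. Mikhalkin, I. Zharkov, LN UMI 15 (2014), Def. 4.2, Prop. 4.3, Thm. 5.4.
-/

set_option linter.dupNamespace false

noncomputable section

open scoped BigOperators
open Matrix
open Literature.AlgebraicGeometry.Tropical
open Summit.HodgeConjecture.HodgeConjecture.Theorems.TropicalHodgeBound

namespace Summit.HodgeConjecture.HodgeConjecture.Theorems.TropicalWeilVanishing.FrameSpan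

/-! ## §0 Display-only notation (the K3 skeleton's local definitions, verbatim bodies; nothing is defined) -/

/-- `P = [1 | i·1]`, the `n × 2n` matrix of `dz₁ ∧ … ∧ dz_n`. -/
local notation3 (prettyPrint := false) "𝐏⟦" n "⟧" =>
  (Matrix.of fun (k : Fin n) (a : Fin (2 * n)) =>
    (if (a : ℕ) = (k : ℕ) then (1 : ℂ) else 0) + (if (a : ℕ) = (k : ℕ) + n then Complex.I else 0))

/-- The skeleton's `dzCoord n S`. -/
local notation3 (prettyPrint := false) "dz⟦" n "⟧" S:max =>
  (Matrix.det (Matrix.of fun k a : Fin n =>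
    (if (S a : ℕ) = (k : ℕ) then (1 : ℂ) else 0) + (if (S a : ℕ) = (k : ℕ) + n then Complex.I else 0)))

/-- The skeleton's `weilPairing n C` (the value `Ŵ(C)` of `dz ⊗ dz`). -/
local notation3 (prettyPrint := false) "Ŵ⟦" n "⟧" C:max =>
  (∑ S : Fin n → Fin (2 * n), ∑ S' : Fin n → Fin (2 * n),
    dz⟦n⟧ S * dz⟦n⟧ S' / ((Nat.factorial n : ℂ) ^ 2) * ((C S S' : ℝ) : ℂ))

/-- The hermitian pairing `M̂(C)` (the value of `dz ⊗ dz̄` on `C`). -/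
local notation3 (prettyPrint := false) "M̂⟦" n "⟧" C:max =>
  (∑ S : Fin n → Fin (2 * n), ∑ S' : Fin n → Fin (2 * n),
    dz⟦n⟧ S * (starRingEnd ℂ) (dz⟦n⟧ S') / ((Nat.factorial n : ℂ) ^ 2) * ((C S S' : ℝ) : ℂ))

/-- The skeleton's `thetaClass n Q`. -/
local notation3 (prettyPrint := false) "θ⟦" n "⟧" Q:max =>
  (fun S S' : Fin n → Fin (2 * n) => Matrix.det (Matrix.submatrix Q S S'))

/-- The skeleton's `omegaFrame n` (`Ω = Pᴴ`). -/
local notation3 (prettyPrint := false) "Ω⟦" n "⟧" =>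
  (Matrix.of fun (a : Fin (2 * n)) (b : Fin n) =>
    (if (a : ℕ) = (b : ℕ) then (1 : ℂ) else 0) - (if (a : ℕ) = (b : ℕ) + n then Complex.I else 0))

/-- The skeleton's `weilClassC n Q` (`w(Q) = (⋀ⁿQ ⊗ 1)(Ω ⊗ Ω)`). -/
local notation3 (prettyPrint := false) "wC⟦" n "⟧" Q:max =>
  (fun S S' : Fin n → Fin (2 * n) =>
    Matrix.det (Matrix.submatrix (Matrix.map Q ((↑) : ℝ → ℂ) * Ω⟦n⟧) S id) *
      Matrix.det (Matrix.submatrix (Ω⟦n⟧) S' id))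

/-- The skeleton's `weilClassRe n Q` (`w₁ = Re w`). -/
local notation3 (prettyPrint := false) "wRe⟦" n "⟧" Q:max =>
  (fun S S' : Fin n → Fin (2 * n) => Complex.re ((wC⟦n⟧ Q) S S'))

/-- The skeleton's `weilClassIm n Q` (`w₂ = Im w`). -/
local notation3 (prettyPrint := false) "wIm⟦" n "⟧" Q:max =>
  (fun S S' : Fin n → Fin (2 * n) => Complex.im ((wC⟦n⟧ Q) S S'))

/-- `M_Q := ½ · P Q Pᴴ`, the matrix of `Q|_{V^{1,0}}` in the frame `Ω` (`QΩ = Ω M_Q`). Nothing is defined. -/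
local notation3 (prettyPrint := false) "𝐌⟦" n "⟧" Q:max =>
  ((2 : ℂ)⁻¹ • (𝐏⟦n⟧ * Matrix.map Q ((↑) : ℝ → ℂ) * (𝐏⟦n⟧)ᴴ))

/-- NEW display-only notation: the `Ω`-minor `Ω(S) := det Ω⟦4⟧[S,·] ∈ ℤ[i]` of a word `S` (the value of
`dz̄₁ ∧ dz̄₂ ∧ dz̄₃ ∧ dz̄₄` on `e_S`). Nothing is defined. -/
local notation3 (prettyPrint := false) "Ωm" S:max => (Matrix.det (Matrix.submatrix (Ω⟦4⟧) S id))

/-! ## §4 The annihilator of the frames lies in the Weil plane of forms (all words) -/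

/-- **FRAME-SPAN THEOREM (annihilator form).** On a very general principally polarised tropical Weil eightfold
`ℝ⁸/Qℤ⁸` (`Q ≻ 0`, `QJ = JQ`, `IsWeilGeneric 4 Q`), let `Z` be a NON-EMPTY effective tropical `4`-cycle and `y` a
real function on words `Fin 4 → Fin 8` with `Σ_S p_σ(S) y(S) = 0` for the Plücker vector `p_σ` of every cell. Then
the alternating projection `T ↦ Σ_{S'} det 1[T,S'] y(S')` of `y` (`= 4!·y` for alternating `y`) is a real linear
combination of `Re Ω` and `Im Ω`, `Ω(T) = det Ω⟦4⟧[T,·]` — i.e. modulo non-alternating noise, the only linear forms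
on `⋀⁴ℝ⁸` that can vanish on all frames of `Z` are those of the Weil plane `span{Re dz̄, Im dz̄}`; dually, the frames
of `Z` span at least the `68`-dimensional kernel of `dz₁ ∧ dz₂ ∧ dz₃ ∧ dz₄` on `⋀⁴ℝ⁸`.
[cite: Zharkov2020TropicalWeil, §2] [cite: MikhalkinZharkov2014Eigenwave, Prop. 4.3 and Thm. 5.4] -/
theorem alt_annihilator_mem_weilPlane (Q : Matrix (Fin (2 * 4)) (Fin (2 * 4)) ℝ) (hQ : Q.PosDef)
    (hJ : Q * weilJ 4 = weilJ 4 * Q) (hgen : IsWeilGeneric 4 Q) (Z : TropicalTorusCycle (2 * 4) 4 Q)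
    (hZ : 0 < Z.numCells) (y : (Fin 4 → Fin (2 * 4)) → ℝ)
    (hy : ∀ σ, ∑ S : Fin 4 → Fin (2 * 4), ((pluckerCoord (Z.cell σ).frame S : ℤ) : ℝ) * y S = 0) :
    ∃ a b : ℝ, ∀ T : Fin 4 → Fin (2 * 4),
      ∑ S' : Fin 4 → Fin (2 * 4), ((1 : Matrix (Fin (2 * 4)) (Fin (2 * 4)) ℝ).submatrix T S').det * y S' =
        a * (Ωm T).re + b * (Ωm T).im := by
  obtain ⟨q, hq, hq0, -⟩ := exists_coordinates_pos Q hQ hJ hgen Z hZ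
  have hQd : IsUnit Q.det := isUnit_iff_ne_zero.mpr hQ.det_pos.ne'
  have hq' : TropicalTorusCycle.cyc Z = ((q 0 : ℚ) : ℝ) • θ⟦4⟧ Q + ((q 1 : ℚ) : ℝ) • wRe⟦4⟧ Q +
      ((q 2 : ℚ) : ℝ) • wIm⟦4⟧ Q := hq
  set ξ : ℂ := -((((((q 1 : ℚ) : ℝ) : ℝ) : ℂ) - Complex.I * ((((q 2 : ℚ) : ℝ) : ℝ) : ℂ)) /
      ((((q 0 : ℚ) : ℝ) : ℝ) : ℂ)) * ∑ S : Fin 4 → Fin (2 * 4), Ωm S * ((y S : ℝ) : ℂ) with hξ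
  refine ⟨ξ.re, -ξ.im, fun T => ?_⟩
  rw [alt_eq_re_of_annihilates hQd hJ Z _ _ _ hq' (by exact_mod_cast hq0.ne') y hy T, Complex.mul_re]
  ring

/-- **Complement form.** If in addition `y` is orthogonal to `Re Ω` and `Im Ω` (`Σ_S Re Ω(S) y(S) = Σ_S Im Ω(S) y(S) = 0`),
then its alternating projection vanishes: the frames of `Z` together with `Re Ω`, `Im Ω` leave no alternating form
unaccounted for (they span `⋀⁴ℝ⁸`). [cite: Zharkov2020TropicalWeil, §2] [cite: MikhalkinZharkov2014Eigenwave, Prop. 4.3] -/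
theorem alt_eq_zero_of_annihilator_orthogonal_omega (Q : Matrix (Fin (2 * 4)) (Fin (2 * 4)) ℝ) (hQ : Q.PosDef)
    (hJ : Q * weilJ 4 = weilJ 4 * Q) (hgen : IsWeilGeneric 4 Q) (Z : TropicalTorusCycle (2 * 4) 4 Q)
    (hZ : 0 < Z.numCells) (y : (Fin 4 → Fin (2 * 4)) → ℝ)
    (hy : ∀ σ, ∑ S : Fin 4 → Fin (2 * 4), ((pluckerCoord (Z.cell σ).frame S : ℤ) : ℝ) * y S = 0)
    (hre : ∑ S : Fin 4 → Fin (2 * 4), (Ωm S).re * y S = 0)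
    (him : ∑ S : Fin 4 → Fin (2 * 4), (Ωm S).im * y S = 0) (T : Fin 4 → Fin (2 * 4)) :
    ∑ S' : Fin 4 → Fin (2 * 4), ((1 : Matrix (Fin (2 * 4)) (Fin (2 * 4)) ℝ).submatrix T S').det * y S' = 0 := by
  obtain ⟨q, hq, hq0, -⟩ := exists_coordinates_pos Q hQ hJ hgen Z hZ
  have hQd : IsUnit Q.det := isUnit_iff_ne_zero.mpr hQ.det_pos.ne'
  have hq' : TropicalTorusCycle.cyc Z = ((q 0 : ℚ) : ℝ) • θ⟦4⟧ Q + ((q 1 : ℚ) : ℝ) • wRe⟦4⟧ Q +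
      ((q 2 : ℚ) : ℝ) • wIm⟦4⟧ Q := hq
  have hz : ∑ S : Fin 4 → Fin (2 * 4), Ωm S * ((y S : ℝ) : ℂ) = 0 := by
    apply Complex.ext
    · rw [Complex.re_sum, Complex.zero_re, ← hre]
      exact Finset.sum_congr rfl fun S _ => Complex.re_mul_ofReal _ _
    · rw [Complex.im_sum, Complex.zero_im, ← him]
      exact Finset.sum_congr rfl fun S _ => Complex.im_mul_ofReal _ _
  rw [alt_eq_re_of_annihilates hQd hJ Z _ _ _ hq' (by exact_mod_cast hq0.ne') y hy T, hz]
  simp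

/-- **If `W(Z) = 0` the frames alone account for every alternating form.** When the Weil functional of the non-empty
effective cycle vanishes (as the open crux K1 predicts for every `Z`), `cyc Z = r·θ₄(Q)` (p329881) and the annihilator
of the frames has zero alternating projection: the Plücker vectors of the cells span all of `⋀⁴ℝ⁸`.
[cite: Zharkov2020TropicalWeil, §2] [cite: MikhalkinZharkov2014Eigenwave, Prop. 4.3] -/
theorem alt_eq_zero_of_annihilator_of_weilFunctional_eq_zero (Q : Matrix (Fin (2 * 4)) (Fin (2 * 4)) ℝ)
    (hQ : Q.PosDef) (hJ : Q * weilJ 4 = weilJ 4 * Q) (hgen : IsWeilGeneric 4 Q) (Z : TropicalTorusCycle (2 * 4) 4 Q)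
    (hZ : 0 < Z.numCells) (hW : weilFunctional Z = 0) (y : (Fin 4 → Fin (2 * 4)) → ℝ)
    (hy : ∀ σ, ∑ S : Fin 4 → Fin (2 * 4), ((pluckerCoord (Z.cell σ).frame S : ℤ) : ℝ) * y S = 0)
    (T : Fin 4 → Fin (2 * 4)) :
    ∑ S' : Fin 4 → Fin (2 * 4), ((1 : Matrix (Fin (2 * 4)) (Fin (2 * 4)) ℝ).submatrix T S').det * y S' = 0 := by
  obtain ⟨r, hr⟩ := cyc_eq_ratCast_smul_thetaClass_of_weilFunctional_eq_zero Q hQ hJ hgen Z hW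
  have hQd : IsUnit Q.det := isUnit_iff_ne_zero.mpr hQ.det_pos.ne'
  have hr0 : ((r : ℚ) : ℝ) ≠ 0 := by
    intro h0
    refine cyc_ne_zero Z hZ ?_
    rw [hr, h0, zero_smul]
  have hq' : TropicalTorusCycle.cyc Z = ((r : ℚ) : ℝ) • θ⟦4⟧ Q + (0 : ℝ) • wRe⟦4⟧ Q + (0 : ℝ) • wIm⟦4⟧ Q := by
    rw [hr, zero_smul, zero_smul, add_zero, add_zero]
  rw [alt_eq_re_of_annihilates hQd hJ Z _ _ _ hq' hr0 y hy T]
  simp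

/-! ## §5 Counting directions: the `70` increasing words and the rank of the frame span -/

/-- **Kronecker table on increasing words** (decided): `det 1[I_i, I_j] = [i = j]` for K3's increasing words
`I_r = Chk.wordOfRank r`, `r < 70`. [folklore] -/
theorem thetaZ_wordOfRank : ∀ i j : Fin 70,
    Chk.thetaZ (Chk.wordOfRank i) (Chk.wordOfRank j) = if i = j then 1 else 0 := by
  decide +kernel

/-- Some increasing word has `Ω`-minor `1` (decided; the word `(0,1,2,3)`). [folklore] -/
theorem exists_omegaMinorF_wordOfRank_eq_one : ∃ r : Fin 70, Chk.omegaMinorF (Chk.wordOfRank r) = 1 := by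
  decide +kernel

/-- Pairing with the LIFT `S ↦ Σ_r [S = I_r] c_r` of `c : Fin 70 → ℝ` (a real function on all words supported on the
increasing words) is the finite pairing on increasing words. [folklore] -/
theorem sum_mul_lift (f : (Fin 4 → Fin (2 * 4)) → ℝ) (c : Fin 70 → ℝ) :
    ∑ S : Fin 4 → Fin (2 * 4), f S * (∑ r : Fin 70, if S = Chk.wordOfRank r then c r else 0) =
      ∑ r : Fin 70, f (Chk.wordOfRank r) * c r := by
  simp_rw [Finset.mul_sum]
  rw [Finset.sum_comm]
  refine Finset.sum_congr rfl fun r _ => ?_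
  simp_rw [mul_ite, mul_zero]
  rw [Finset.sum_ite_eq' Finset.univ (Chk.wordOfRank r)]
  simp

/-- Complex pairing with a lift. [folklore] -/
theorem sum_mul_lift_complex (f : (Fin 4 → Fin (2 * 4)) → ℂ) (c : Fin 70 → ℝ) :
    ∑ S : Fin 4 → Fin (2 * 4), f S * (((∑ r : Fin 70, if S = Chk.wordOfRank r then c r else 0 : ℝ) : ℝ) : ℂ) =
      ∑ r : Fin 70, f (Chk.wordOfRank r) * ((c r : ℝ) : ℂ) := by
  push_cast
  simp_rw [Finset.mul_sum]
  rw [Finset.sum_comm]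
  refine Finset.sum_congr rfl fun r _ => ?_
  simp_rw [apply_ite (fun x : ℝ => (x : ℂ)), Complex.ofReal_zero, mul_ite, mul_zero]
  rw [Finset.sum_ite_eq' Finset.univ (Chk.wordOfRank r)]
  simp

/-- The alternating projection of a lift, read on increasing words, is the identity: `Σ_{S'} det 1[I_t,S'] (lift c)(S') = c_t`.
[folklore] -/
theorem alt_lift (c : Fin 70 → ℝ) (t : Fin 70) :
    ∑ S' : Fin 4 → Fin (2 * 4), ((1 : Matrix (Fin (2 * 4)) (Fin (2 * 4)) ℝ).submatrix (Chk.wordOfRank t) S').det *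
      (∑ r : Fin 70, if S' = Chk.wordOfRank r then c r else 0) = c t := by
  rw [sum_mul_lift]
  simp_rw [← thetaZ_cast, thetaZ_wordOfRank t]
  simp


/-- The increasing-word `Ω`-vector has a coordinate equal to `1`. [folklore] -/
theorem exists_omega_wordOfRank_eq_one : ∃ r : Fin 70, Ωm (Chk.wordOfRank r) = 1 := by
  obtain ⟨r, hr⟩ := exists_omegaMinorF_wordOfRank_eq_one
  exact ⟨r, by rw [← omegaMinorF_toComplex, hr, map_one]⟩

/-- **Annihilators of the restricted frames are pairwise dependent.** For a non-empty effective `4`-cycle `Z` at a very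
general Weil period, any two vectors `c₁, c₂ ∈ ℝ⁷⁰` orthogonal to all restricted Plücker vectors
`(p_σ(I_r))_{r<70}` are linearly dependent: the annihilator is at most a LINE (inside the Weil plane). Proof: by the
master identity `c = Re(λ z_c Ω̂)` with `z_c = Σ_r Ω(I_r) c_r`, `λ = -(q₁ - iq₂)/q₀`; re-inserting gives
`(2 - λP) z_c = N λ̄ z̄_c` with `N = Σ_r |Ω(I_r)|² > 0`, whence `z̄_{c₁} z_{c₂} ∈ ℝ`.
[cite: Zharkov2020TropicalWeil, §2] [cite: MikhalkinZharkov2014Eigenwave, Prop. 4.3] -/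
theorem annihilator_pairwise_dependent (Q : Matrix (Fin (2 * 4)) (Fin (2 * 4)) ℝ) (hQ : Q.PosDef)
    (hJ : Q * weilJ 4 = weilJ 4 * Q) (hgen : IsWeilGeneric 4 Q) (Z : TropicalTorusCycle (2 * 4) 4 Q)
    (hZ : 0 < Z.numCells) (c₁ c₂ : Fin 70 → ℝ)
    (h₁ : ∀ σ, ∑ r : Fin 70, ((pluckerCoord (Z.cell σ).frame (Chk.wordOfRank r) : ℤ) : ℝ) * c₁ r = 0)
    (h₂ : ∀ σ, ∑ r : Fin 70, ((pluckerCoord (Z.cell σ).frame (Chk.wordOfRank r) : ℤ) : ℝ) * c₂ r = 0) :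
    ∃ t : ℝ × ℝ, t ≠ 0 ∧ t.1 • c₁ + t.2 • c₂ = 0 := by
  obtain ⟨q, hq, hq0, -⟩ := exists_coordinates_pos Q hQ hJ hgen Z hZ
  have hQd : IsUnit Q.det := isUnit_iff_ne_zero.mpr hQ.det_pos.ne'
  have hq' : TropicalTorusCycle.cyc Z = ((q 0 : ℚ) : ℝ) • θ⟦4⟧ Q + ((q 1 : ℚ) : ℝ) • wRe⟦4⟧ Q +
      ((q 2 : ℚ) : ℝ) • wIm⟦4⟧ Q := hq
  have hq0' : ((q 0 : ℚ) : ℝ) ≠ 0 := by exact_mod_cast hq0.ne'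
  set lam : ℂ := -(((((q 1 : ℚ) : ℝ) : ℂ) - Complex.I * ((((q 2 : ℚ) : ℝ) : ℝ) : ℂ)) / ((((q 0 : ℚ) : ℝ) : ℝ) : ℂ))
    with hlam
  set Ωv : Fin 70 → ℂ := fun r => Ωm (Chk.wordOfRank r) with hΩv
  -- the master identity read on increasing words
  have key : ∀ c : Fin 70 → ℝ,
      (∀ σ, ∑ r : Fin 70, ((pluckerCoord (Z.cell σ).frame (Chk.wordOfRank r) : ℤ) : ℝ) * c r = 0) →
      ∀ t : Fin 70, c t = (lam * (∑ r, Ωv r * ((c r : ℝ) : ℂ)) * Ωv t).re := by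
    intro c hc t
    have hy : ∀ σ, ∑ S : Fin 4 → Fin (2 * 4), ((pluckerCoord (Z.cell σ).frame S : ℤ) : ℝ) *
        (∑ r : Fin 70, if S = Chk.wordOfRank r then c r else 0) = 0 :=
      fun σ => by rw [sum_mul_lift]; exact hc σ
    have h := alt_eq_re_of_annihilates hQd hJ Z _ _ _ hq' hq0'
      (fun S => ∑ r : Fin 70, if S = Chk.wordOfRank r then c r else 0) hy (Chk.wordOfRank t)
    beta_reduce at h
    rw [alt_lift, sum_mul_lift_complex] at h
    exact h
  -- the quadratic relation `2 z = lam P z + N conj(lam) conj(z)`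
  set P : ℂ := ∑ r, Ωv r * Ωv r with hP
  set N : ℂ := ∑ r, Ωv r * (starRingEnd ℂ) (Ωv r) with hN
  have hE : ∀ (c : Fin 70 → ℝ) (z : ℂ), (∀ t, c t = (lam * z * Ωv t).re) →
      z = ∑ r, Ωv r * ((c r : ℝ) : ℂ) → 2 * z = lam * P * z + N * (starRingEnd ℂ) lam * (starRingEnd ℂ) z := by
    intro c z hc hz
    have hz' : z = ∑ r, Ωv r * (((lam * z * Ωv r).re : ℝ) : ℂ) := by
      conv_lhs => rw [hz]
      exact Finset.sum_congr rfl fun r _ => by rw [← hc r]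
    have hterm : ∀ r, (2 : ℂ) * (Ωv r * (((lam * z * Ωv r).re : ℝ) : ℂ)) =
        lam * (Ωv r * Ωv r) * z + Ωv r * (starRingEnd ℂ) (Ωv r) * (starRingEnd ℂ) lam * (starRingEnd ℂ) z := by
      intro r
      rw [Complex.re_eq_add_conj, map_mul, map_mul]
      ring
    calc 2 * z = ∑ r, (2 : ℂ) * (Ωv r * (((lam * z * Ωv r).re : ℝ) : ℂ)) := by
          conv_lhs => rw [hz']
          rw [Finset.mul_sum]
      _ = ∑ r, (lam * (Ωv r * Ωv r) * z + Ωv r * (starRingEnd ℂ) (Ωv r) * (starRingEnd ℂ) lam * (starRingEnd ℂ) z) :=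
          Finset.sum_congr rfl fun r _ => hterm r
      _ = lam * P * z + N * (starRingEnd ℂ) lam * (starRingEnd ℂ) z := by
          rw [Finset.sum_add_distrib, hP, hN, Finset.mul_sum, Finset.sum_mul, Finset.sum_mul, Finset.sum_mul]
  -- N is a positive real
  have hN0 : N ≠ 0 := by
    obtain ⟨r₀, hr₀⟩ := exists_omega_wordOfRank_eq_one
    have hNre : N = ((∑ r, Complex.normSq (Ωv r) : ℝ) : ℂ) := by
      rw [hN]; push_cast; exact Finset.sum_congr rfl fun r _ => Complex.mul_conj (Ωv r)
    have hpos : 0 < ∑ r, Complex.normSq (Ωv r) := by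
      refine lt_of_lt_of_le ?_ (Finset.single_le_sum (fun r _ => Complex.normSq_nonneg (Ωv r)) (Finset.mem_univ r₀))
      have : Ωv r₀ = 1 := hr₀
      rw [this, Complex.normSq_one]; exact one_pos
    rw [hNre]; exact_mod_cast hpos.ne'
  set z₁ : ℂ := ∑ r, Ωv r * ((c₁ r : ℝ) : ℂ) with hz₁
  set z₂ : ℂ := ∑ r, Ωv r * ((c₂ r : ℝ) : ℂ) with hz₂
  have hc₁ : ∀ t, c₁ t = (lam * z₁ * Ωv t).re := key c₁ h₁
  have hc₂ : ∀ t, c₂ t = (lam * z₂ * Ωv t).re := key c₂ h₂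
  -- trivial case: `c₁ = 0`
  by_cases hz10 : lam * z₁ = 0
  · refine ⟨(1, 0), by simp, ?_⟩
    ext t
    simp only [Pi.add_apply, Pi.smul_apply, smul_eq_mul, one_mul, zero_mul, add_zero, Pi.zero_apply]
    rw [hc₁ t, hz10, zero_mul, Complex.zero_re]
  have hlam : lam ≠ 0 := fun h => hz10 (by rw [h, zero_mul])
  have hz1 : z₁ ≠ 0 := fun h => hz10 (by rw [h, mul_zero])
  have E₁ := hE c₁ z₁ hc₁ rfl
  have E₂ := hE c₂ z₂ hc₂ rfl
  -- `conj z₁ * z₂` is real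
  have hνne : N * (starRingEnd ℂ) lam ≠ 0 := mul_ne_zero hN0 (by simpa using hlam)
  have hreal : (starRingEnd ℂ) z₁ * z₂ = (starRingEnd ℂ) z₂ * z₁ := by
    have e : N * (starRingEnd ℂ) lam * ((starRingEnd ℂ) z₁ * z₂ - (starRingEnd ℂ) z₂ * z₁) = 0 := by
      have e1 : N * (starRingEnd ℂ) lam * (starRingEnd ℂ) z₁ * z₂ = (2 - lam * P) * z₁ * z₂ := by
        rw [show N * (starRingEnd ℂ) lam * (starRingEnd ℂ) z₁ = 2 * z₁ - lam * P * z₁ by rw [E₁]; ring]; ring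
      have e2 : N * (starRingEnd ℂ) lam * (starRingEnd ℂ) z₂ * z₁ = (2 - lam * P) * z₂ * z₁ := by
        rw [show N * (starRingEnd ℂ) lam * (starRingEnd ℂ) z₂ = 2 * z₂ - lam * P * z₂ by rw [E₂]; ring]; ring
      calc N * (starRingEnd ℂ) lam * ((starRingEnd ℂ) z₁ * z₂ - (starRingEnd ℂ) z₂ * z₁)
          = N * (starRingEnd ℂ) lam * (starRingEnd ℂ) z₁ * z₂ - N * (starRingEnd ℂ) lam * (starRingEnd ℂ) z₂ * z₁ := by
            ring
        _ = 0 := by rw [e1, e2]; ring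
    have := (mul_eq_zero.mp e).resolve_left hνne
    exact sub_eq_zero.mp this
  -- `z₂ = t₀ z₁` with `t₀` real
  have hsreal : (starRingEnd ℂ) z₁ * z₂ = (((((starRingEnd ℂ) z₁ * z₂).re : ℝ)) : ℂ) := by
    have hconj : (starRingEnd ℂ) ((starRingEnd ℂ) z₁ * z₂) = (starRingEnd ℂ) z₁ * z₂ := by
      rw [map_mul, Complex.conj_conj, hreal]; ring
    exact (Complex.conj_eq_iff_re.mp hconj).symm
  obtain ⟨t₀, ht₀⟩ : ∃ t₀ : ℝ, t₀ = ((starRingEnd ℂ) z₁ * z₂).re / Complex.normSq z₁ := ⟨_, rfl⟩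
  have hz₂ : z₂ = ((t₀ : ℝ) : ℂ) * z₁ := by
    have hc1 : (starRingEnd ℂ) z₁ ≠ 0 := by simpa using hz1
    have hn : ((Complex.normSq z₁ : ℝ) : ℂ) ≠ 0 := by exact_mod_cast (by simpa using hz1 : Complex.normSq z₁ ≠ 0)
    apply mul_left_cancel₀ hc1
    have e : (starRingEnd ℂ) z₁ * (((t₀ : ℝ) : ℂ) * z₁) = ((t₀ : ℝ) : ℂ) * (z₁ * (starRingEnd ℂ) z₁) := by ring
    rw [e, Complex.mul_conj, ht₀]
    conv_lhs => rw [hsreal]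
    push_cast
    field_simp
  refine ⟨(t₀, -1), by simp, ?_⟩
  ext t
  simp only [Pi.add_apply, Pi.smul_apply, smul_eq_mul, Pi.zero_apply, neg_one_mul]
  have e : lam * (((t₀ : ℝ) : ℂ) * z₁) * Ωv t = ((t₀ : ℝ) : ℂ) * (lam * z₁ * Ωv t) := by ring
  rw [hc₁ t, hc₂ t, hz₂, e, Complex.re_ofReal_mul]
  ring

end Summit.HodgeConjecture.HodgeConjecture.Theorems.TropicalWeilVanishing.FrameSpan

end
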